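import Literature.AlgebraicGeometry.Resolution.DehomogenizationChartPrimes
import Literature.AlgebraicGeometry.Resolution.KawasakiHomogeneousAnnihilator
import Literature.AlgebraicGeometry.Resolution.KawasakiChartBaseChange
import Literature.AlgebraicGeometry.Resolution.KawasakiFormSelection
import Literature.AlgebraicGeometry.Resolution.AffineEquidimensionalIdeals
import Literature.AlgebraicGeometry.Resolution.ProjectiveSpaceRegular
import HarnessLib

/-!
# Kawasaki's forms for an embedded projective variety: the annihilator assignment, the key lemma,
# and the selection read on the charts

Topic: `Literature/AlgebraicGeometry/Resolution` (Kawasaki 2000, §5: La. 5.3 — the choice of the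
forms `z_1, …, z_d` with `z_i ∈ ∏ ann Hʲ(Hom(R/(z_{i+1},…,z_d)R, D))` of the right heights — for the
homogeneous coordinate ring of an embedded `Z ⊆ ℙⁿ_k`, assembled from the tree's pieces: the
abstract graded selection `KawasakiFormSelection.exists_forms_avoiding_minimalPrimes`, the
homogeneous annihilator ideal and its key lemma `KawasakiHomogeneousAnnihilator.lean`, the
two-chart compatibility `KawasakiChartBaseChange.lean`, and the graded-to-chart dictionary
`DehomogenizationChartPrimes.lean`).

For a closed immersion `ι : Z → ℙⁿ_k`:

* `chartIdealOf ι J j` — the ideal of `Γ(Z, Z_{x_j})` generated by the evaluated dehomogenisations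
  of the forms of `J`; `annWindow J = (n + 1 - dim k[x]/J, max n 2]`; `annAssign ι J` — Kawasaki's
  homogeneous ideal `𝔞(J)` (span of the forms whose dehomogenisations lie in every chart annihilator
  `chartAnn ι j (chartIdealOf ι J j) (annWindow J)`); `chartAnn_chartIdealOf_map_awayMap_eq` (the
  two-chart compatibility of these chart ideals), `dehomAway_mem_chartAnn_of_mem_annAssign`;
* `exists_posHomog_annAssign_notMem` — **the key lemma**: for `J` homogeneous with all minimal
  primes of dimension `e ≥ 1`, `𝔞(J)` has a positive-degree form outside each minimal prime `𝔭` of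
  `J` (`𝔭` misses some `x_j`; its dehomogenisation is a chart prime of height `≤ n + 1 - e`, which the
  chart `Ext`-annihilator avoids);
* `exists_kawasakiForms` — **the selection for a homogeneous prime `P` of dimension `d + 1`**, in
  KAWASAKI's order `z_0, …, z_{d-1}` (re-indexed by `Fin.rev` from the selection order): positive
  degrees, `z_{d-1} ∉ P`, `dim k[x]/(P + (z_l,…,z_{d-1})) = l + 1`, and for every chart `j` the
  membership of `ρ_j(z_l)` in the chart annihilator of the chart ideal of `P + (z_{l+1},…,z_{d-1})`
  for the window `(n - (l+1), max n 2]` — the hypothesis `hann` of `KawasakiPointwise.lean`;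
* `chartIdealOf_sup_span_eq`, `chartIdealOf_sup_span_image_eq_ofList`,
  `ringKrullDim_chartQuot_chartIdealOf_le` — the chart ideals of `P + (forms)` when `P` dies on the
  chart (`= (z_l,…)𝒪`, in the `Ideal.ofList` currency of the pointwise step) and their dimension bound
  (the hypothesis `hdimJ` of `KawasakiPointwise.lean`, via `KawasakiChartStalk.ringKrullDim_stalkQuot_le`).

Definitions: `chartIdealOf`, `annWindow`, `annAssign` (and a private degree choice); everything else
proved; no named facts.

## References

* T. Kawasaki, *On Macaulayfication of Noetherian schemes*, Trans. AMS 352 (2000), La. 5.3 and the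
  proof of Thm. 5.1 (p. 2539). [Kawasaki2000]
* W. Bruns, J. Herzog, *Cohen–Macaulay rings*, CUP 1998, La. 1.5.6 (minimal primes of graded
  ideals are graded). [BrunsHerzog1998]
-/

noncomputable section

open CategoryTheory AlgebraicGeometry TopologicalSpace HomogeneousLocalization MvPolynomial
open Literature.AlgebraicGeometry.Morphisms Literature.AlgebraicGeometry.Morphisms.ProjCech
open Literature.AlgebraicGeometry.Motives Literature.AlgebraicGeometry.Motives.ProjFrac

universe u

attribute [local instance] MvPolynomial.gradedAlgebra
  Literature.AlgebraicGeometry.Motives.ProjBaseChange.algebraBase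

namespace Literature.AlgebraicGeometry.Resolution

variable {k : Type u} [Field k] {n : ℕ} {Z : Scheme.{u}} (ι : Z ⟶ PP k n) [IsClosedImmersion ι]

/-! ## The chart ideals of a homogeneous ideal and Kawasaki's annihilator assignment -/

/-- A degree of a homogeneous element (a choice; for a non-zero element it is its degree).
[folklore] -/
private def hdeg {J : Ideal (MvPolynomial (Fin (n + 1)) k)}
    (s : {s : MvPolynomial (Fin (n + 1)) k // s ∈ J ∧ SetLike.IsHomogeneousElem (grading k n) s}) :
    ℕ :=
  Classical.choose s.2.2

omit [IsClosedImmersion ι] in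
/-- The chosen degree is a degree. [folklore] -/
private theorem hdeg_mem {J : Ideal (MvPolynomial (Fin (n + 1)) k)}
    (s : {s : MvPolynomial (Fin (n + 1)) k // s ∈ J ∧ SetLike.IsHomogeneousElem (grading k n) s}) :
    s.1 ∈ grading k n (hdeg s • 1) := by
  unfold hdeg
  simpa using Classical.choose_spec s.2.2

/-- **The chart ideal of `J` on `Z_{x_j}`**: the ideal of `Γ(Z, Z_{x_j})` generated by the evaluated
dehomogenisations `ρ_j(s)|_Z = (s / x_j^{deg s})|_Z` of the FORMS `s ∈ J` (for the ideals
`J = I_Z + (z_{i+1}, …, z_d)` of Kawasaki's proof of Thm. 5.1 this is the ideal `(z_{i+1}, …, z_d)𝒪_Z`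
of the chart, see `chartIdealOf_sup_span_eq`); written in the `Away.mk` currency of
`KawasakiChartBaseChange.chartAnn_map_awayMap_eq_of_forms`. [cite: Kawasaki2000, Thm. 5.1 (proof, p. 2539)] -/
def chartIdealOf (J : Ideal (MvPolynomial (Fin (n + 1)) k)) (j : Fin (n + 1)) :
    Ideal Γ(Z, ZH ι (X j : MvPolynomial (Fin (n + 1)) k)) :=
  Ideal.span (Set.range fun s : {s : MvPolynomial (Fin (n + 1)) k //
      s ∈ J ∧ SetLike.IsHomogeneousElem (grading k n) s} =>
    evalAway ι (X j) (Away.mk (grading k n) (Segre.X_mem k j) (hdeg s) s.1 (hdeg_mem s)))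

omit [IsClosedImmersion ι] in
/-- The evaluated dehomogenisation of a form of `J` lies in the chart ideal of `J`.
[cite: Kawasaki2000, Thm. 5.1 (proof, p. 2539)] -/
theorem evalAway_dehomAway_mem_chartIdealOf {J : Ideal (MvPolynomial (Fin (n + 1)) k)}
    (j : Fin (n + 1)) {s : MvPolynomial (Fin (n + 1)) k} (hs : s ∈ J) {m : ℕ}
    (hm : s ∈ grading k n m) : evalAway ι (X j) (dehomAway k n j s) ∈ chartIdealOf ι J j := by
  let s' : {s : MvPolynomial (Fin (n + 1)) k // s ∈ J ∧ SetLike.IsHomogeneousElem (grading k n) s} :=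
    ⟨s, hs, ⟨m, hm⟩⟩
  have hmem : s ∈ grading k n (hdeg s') := by simpa using hdeg_mem s'
  have h : dehomAway k n j s =
      Away.mk (grading k n) (Segre.X_mem k j) (hdeg s') s'.1 (hdeg_mem s') :=
    dehomAway_of_mem j hmem
  rw [h]
  exact Ideal.subset_span ⟨s', rfl⟩

omit [IsClosedImmersion ι] in
/-- The chart ideal of `J` is generated by the evaluated dehomogenisations `ρ_j(s)|_Z` of the forms
`s ∈ J`. [cite: Kawasaki2000, Thm. 5.1 (proof, p. 2539)] -/
theorem chartIdealOf_eq_span_dehomAway (J : Ideal (MvPolynomial (Fin (n + 1)) k)) (j : Fin (n + 1)) :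
    chartIdealOf ι J j = Ideal.span ((fun s => evalAway ι (X j) (dehomAway k n j s)) ''
      {s : MvPolynomial (Fin (n + 1)) k | s ∈ J ∧ SetLike.IsHomogeneousElem (grading k n) s}) := by
  refine le_antisymm (Ideal.span_le.mpr ?_) (Ideal.span_le.mpr ?_)
  · rintro _ ⟨s, rfl⟩
    have hmem : s.1 ∈ grading k n (hdeg s) := by simpa using hdeg_mem s
    change evalAway ι (X j) (Away.mk (grading k n) (Segre.X_mem k j) (hdeg s) s.1 (hdeg_mem s)) ∈ _
    rw [← dehomAway_of_mem j hmem]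
    exact Ideal.subset_span ⟨s.1, s.2, rfl⟩
  · rintro _ ⟨s, ⟨hs, ⟨m, hm⟩⟩, rfl⟩
    exact evalAway_dehomAway_mem_chartIdealOf ι j hs hm

/-- **The window of `J`**: `(n + 1 - dim k[x]/J, max n 2]`, i.e. `(n - dim V₊(J), max n 2]` — the
`Ext`-indices `q` with `Extq` relevant for Kawasaki's `𝔞` of a subscheme of `ℙⁿ` of the dimension of
`V₊(J)` (Kawasaki's `∏_{j > d-i} ann Hʲ`, La. 5.3 (3), in the `Ext`-form of the tree over the regular
`n`-dimensional charts). [cite: Kawasaki2000, La. 5.3 (3)] -/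
def annWindow (J : Ideal (MvPolynomial (Fin (n + 1)) k)) : Finset ℕ :=
  Finset.Ioc (n + 1 - ((ringKrullDim (MvPolynomial (Fin (n + 1)) k ⧸ J)).unbotD 0).toNat) (max n 2)

omit [IsClosedImmersion ι] in
/-- The window of an ideal with `dim k[x]/J = e` is `(n + 1 - e, max n 2]`. [cite: Kawasaki2000, La. 5.3 (3)] -/
theorem annWindow_eq {J : Ideal (MvPolynomial (Fin (n + 1)) k)} {e : ℕ}
    (he : ringKrullDim (MvPolynomial (Fin (n + 1)) k ⧸ J) = e) :
    annWindow (k := k) (n := n) J = Finset.Ioc (n + 1 - e) (max n 2) := by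
  rw [annWindow, he]
  rfl

/-- **Kawasaki's homogeneous annihilator ideal `𝔞(J)`** of a homogeneous ideal `J ⊇ I_Z`
(`KawasakiHomogeneousAnnihilator.lean`, there written inline): the span of the forms all of whose
dehomogenisations lie in the `Ext`-annihilator ideals `chartAnn` of the chart modules
`Γ(Z, Z_{x_j}) ⧸ (chart ideal of J)`, for the window of `J`.
[cite: Kawasaki2000, La. 5.3 (the ideals `∏ ann Hʲ(Hom(R/(z_{i+1},…,z_d)R, D))`)] -/
def annAssign (J : Ideal (MvPolynomial (Fin (n + 1)) k)) : HomogeneousIdeal (grading k n) :=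
  ⟨Ideal.span {G : MvPolynomial (Fin (n + 1)) k | (∃ m : ℕ, G ∈ grading k n m) ∧
      ∀ j : Fin (n + 1), dehomAway k n j G ∈ chartAnn ι j (chartIdealOf ι J j) (annWindow J)},
    isHomogeneous_span_annForms ι _ _⟩

/-- **Two-chart compatibility of the annihilator ideals of the chart ideals of `J`** (the `hcompat`
of the key lemma; `KawasakiChartBaseChange.chartAnn_map_awayMap_eq_of_forms`).
[cite: Kawasaki2000, La. 5.3] -/
theorem chartAnn_chartIdealOf_map_awayMap_eq (J : Ideal (MvPolynomial (Fin (n + 1)) k))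
    (T : Finset ℕ) (hT : ∀ q ∈ T, 1 ≤ q) (j l : Fin (n + 1)) :
    (chartAnn ι j (chartIdealOf ι J j) T).map (awayMap (grading k n) (Segre.X_mem k l)
        (rfl : (X j * X l : MvPolynomial (Fin (n + 1)) k) = X j * X l)) =
      (chartAnn ι l (chartIdealOf ι J l) T).map (awayMap (grading k n) (Segre.X_mem k j)
        (mul_comm (X j) (X l) : (X j * X l : MvPolynomial (Fin (n + 1)) k) = X l * X j)) := by
  exact chartAnn_map_awayMap_eq_of_forms ι hdeg (fun s => s.1) hdeg_mem T hT j l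

/-- **Forms in `𝔞(J)` dehomogenise into the chart annihilator ideals** (by definition of `𝔞(J)`: the
generating forms do, and `chartAnn` is an ideal). [cite: Kawasaki2000, La. 5.3] -/
theorem dehomAway_mem_chartAnn_of_mem_annAssign {J : Ideal (MvPolynomial (Fin (n + 1)) k)}
    {G : MvPolynomial (Fin (n + 1)) k} (hG : G ∈ (annAssign ι J).toIdeal) (j : Fin (n + 1)) :
    dehomAway k n j G ∈ chartAnn ι j (chartIdealOf ι J j) (annWindow J) := by
  have h : (annAssign ι J).toIdeal ≤ (chartAnn ι j (chartIdealOf ι J j) (annWindow J)).comap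
      (dehomAway k n j) := by
    change Ideal.span _ ≤ _
    rw [Ideal.span_le]
    rintro G' ⟨-, hG'⟩
    exact hG' j
  exact h hG

/-! ## The key lemma: `𝔞(J)` has positive-degree forms outside every minimal prime of `J` -/

omit [IsClosedImmersion ι] in
/-- A minimal prime of a homogeneous ideal is homogeneous (its homogeneous core is a prime between
the ideal and it). [cite: BrunsHerzog1998, La. 1.5.6] -/
theorem isHomogeneous_of_mem_minimalPrimes {J 𝔭 : Ideal (MvPolynomial (Fin (n + 1)) k)}
    (hJ : J.IsHomogeneous (grading k n)) (h𝔭 : 𝔭 ∈ J.minimalPrimes) :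
    𝔭.IsHomogeneous (grading k n) := by
  haveI : 𝔭.IsPrime := h𝔭.1.1
  rw [Ideal.IsHomogeneous.iff_eq]
  refine le_antisymm (Ideal.toIdeal_homogeneousCore_le _ _) ?_
  have hJle : J ≤ (𝔭.homogeneousCore (grading k n)).toIdeal := by
    rw [← hJ.toIdeal_homogeneousCore_eq_self]
    exact Ideal.homogeneousCore_mono (grading k n) h𝔭.1.2
  exact h𝔭.2 ⟨(h𝔭.1.1).homogeneousCore, hJle⟩ (Ideal.toIdeal_homogeneousCore_le _ _)

/-- **The key lemma of the selection** (Kawasaki 2000, La. 5.3, "an easy consequence of prime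
avoidance" — its input): for a homogeneous ideal `J` of `k[x₀,…,xₙ]` all of whose minimal primes have
`dim k[x]/𝔮 = e ≥ 1`, and every minimal prime `𝔭` of `J`, Kawasaki's ideal `𝔞(J)` contains a form of
positive degree outside `𝔭`. Proof: `𝔭` is homogeneous and misses some `x_j`
(`exists_X_not_mem_of_ringKrullDim_quotient_ne_zero`); its dehomogenisation `ρ_j(𝔭)B_j` is a prime of
height `≤ n + 1 - e` (`height_map_dehomAway_le_of_ringKrullDim_quotient`), which the chart annihilator
avoids (`exists_posHomog_annIdeal_notMem_of_chartPrime`, with the two-chart compatibility of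
`KawasakiChartBaseChange.lean`). [cite: Kawasaki2000, La. 5.3] -/
theorem exists_posHomog_annAssign_notMem {J : Ideal (MvPolynomial (Fin (n + 1)) k)}
    (hJ : J.IsHomogeneous (grading k n)) {e : ℕ} (he1 : 1 ≤ e)
    (he : ∀ 𝔮 ∈ J.minimalPrimes, ringKrullDim (MvPolynomial (Fin (n + 1)) k ⧸ 𝔮) = e)
    {𝔭 : Ideal (MvPolynomial (Fin (n + 1)) k)} (h𝔭 : 𝔭 ∈ J.minimalPrimes) :
    ∃ a, GradedPrimeAvoidance.PosHomog (grading k n) (annAssign ι J).toIdeal a ∧ a ∉ 𝔭 := by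
  haveI h𝔭p : 𝔭.IsPrime := h𝔭.1.1
  have h𝔭hom : 𝔭.IsHomogeneous (grading k n) := isHomogeneous_of_mem_minimalPrimes hJ h𝔭
  have hJtop : J ≠ ⊤ := ne_top_of_le_ne_top h𝔭p.ne_top h𝔭.1.2
  have hdimJ : ringKrullDim (MvPolynomial (Fin (n + 1)) k ⧸ J) = e :=
    ringKrullDim_quotient_eq_of_forall_minimalPrimes hJtop fun 𝔮 h𝔮 => he 𝔮 h𝔮
  have hwin : annWindow (k := k) (n := n) J = Finset.Ioc (n + 1 - e) (max n 2) := annWindow_eq hdimJ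
  have hdim𝔭 : ringKrullDim (MvPolynomial (Fin (n + 1)) k ⧸ 𝔭) = e := he 𝔭 h𝔭
  obtain ⟨j, hj⟩ := exists_X_not_mem_of_ringKrullDim_quotient_ne_zero (𝔭 := 𝔭)
    (by rw [hdim𝔭]; exact_mod_cast (by omega : e ≠ 0))
  haveI := isPrime_map_dehomAway j h𝔭hom hj
  haveI := isRegularRing_away_X (k := k) (n := n) j
  have h𝔮 : (𝔭.map (dehomAway k n j)).height ≤ (n + 1 - e : ℕ) :=
    height_map_dehomAway_le_of_ringKrullDim_quotient j h𝔭hom hj hdim𝔭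
  have key := exists_posHomog_annIdeal_notMem_of_chartPrime ι (chartIdealOf ι J)
    (g := n + 1 - e) (N := max n 2)
    (fun j' l' => chartAnn_chartIdealOf_map_awayMap_eq ι J _
      (fun q hq => one_le_of_mem_Ioc hq) j' l')
    hj (𝔭.map (dehomAway k n j)) h𝔮 (fun _ _ _ hG => Ideal.mem_map_of_mem _ hG)
  have hann : (annAssign ι J).toIdeal = Ideal.span {G : MvPolynomial (Fin (n + 1)) k |
      (∃ m : ℕ, G ∈ grading k n m) ∧ ∀ j : Fin (n + 1), dehomAway k n j G ∈
        chartAnn ι j (chartIdealOf ι J j) (Finset.Ioc (n + 1 - e) (max n 2))} := by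
    change Ideal.span _ = _
    rw [hwin]
  rw [hann]
  exact key

/-! ## Index bookkeeping: Kawasaki order versus selection order -/

section Rev

variable {α : Type u} {d : ℕ} (r : Fin d → α)

/-- `{z_i | l ≤ i} = {r_j | j < d - l}` for `z = r ∘ rev`. [folklore] -/
private theorem image_comp_rev_ge (l : ℕ) :
    (fun i => r (Fin.rev i)) '' {i : Fin d | l ≤ (i : ℕ)} = r '' {j : Fin d | (j : ℕ) < d - l} := by
  ext x
  constructor
  · rintro ⟨i, hi, rfl⟩
    exact ⟨Fin.rev i, by simp only [Set.mem_setOf_eq, Fin.val_rev] at hi ⊢; omega, rfl⟩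
  · rintro ⟨j, hj, rfl⟩
    exact ⟨Fin.rev j, by simp only [Set.mem_setOf_eq, Fin.val_rev] at hj ⊢; omega,
      by simp only [Fin.rev_rev]⟩

/-- `{r_j | j < rev l} = {z_i | l + 1 ≤ i}` for `z = r ∘ rev`. [folklore] -/
private theorem image_lt_rev (l : Fin d) :
    r '' {j : Fin d | (j : ℕ) < (Fin.rev l : ℕ)} =
      (fun i => r (Fin.rev i)) '' {i : Fin d | (l : ℕ) + 1 ≤ (i : ℕ)} := by
  have h : {j : Fin d | (j : ℕ) < (Fin.rev l : ℕ)} = {j : Fin d | (j : ℕ) < d - (l + 1)} := by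
    ext j
    simp only [Set.mem_setOf_eq, Fin.val_rev]
  rw [h, image_comp_rev_ge r (l + 1)]

end Rev

/-! ## The selection, in Kawasaki's order, read on the charts -/

omit [IsClosedImmersion ι] in
/-- The irrelevant ideal `(x₀, …, xₙ)` is proper (`1` has non-zero degree-`0` component). [folklore] -/
private theorem irrelevant_ne_top :
    (HomogeneousIdeal.irrelevant (grading k n)).toIdeal ≠ ⊤ := by
  intro h
  have h1 : (1 : MvPolynomial (Fin (n + 1)) k) ∈ (HomogeneousIdeal.irrelevant (grading k n)).toIdeal := by
    rw [h]; exact Submodule.mem_top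
  rw [HomogeneousIdeal.mem_iff, HomogeneousIdeal.mem_irrelevant_iff, GradedRing.proj_apply,
    DirectSum.decompose_of_mem_same (grading k n) (SetLike.GradedOne.one_mem)] at h1
  exact one_ne_zero h1

/-- **Kawasaki's forms for an embedded variety, in his order, read on the charts** (Kawasaki 2000,
La. 5.3 applied to `R = k[x]/I_Z`, then the local reading of the proof of Thm. 5.1, p. 2539). Let
`P` be a homogeneous prime of `k[x₀,…,xₙ]` with `dim k[x]/P = d + 1`, `d ≥ 1` (the homogeneous ideal
of an integral closed `Z ⊆ ℙⁿ` of dimension `d`). There are forms `z_0, …, z_{d-1}` of positive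
degrees `N_i` such that, with `J_l = P + (z_l, …, z_{d-1})`:
* `z_{d-1} ∉ P` (the centre `∏ (z_l, …, z_{d-1})` is non-zero on `Z`);
* `dim k[x]/J_l = l + 1` for `l ≤ d` (`V₊(J_l)` has dimension `l`);
* for every `l < d` and every chart `j`, the dehomogenisation `ρ_j(z_l)` lies in the `Ext`-annihilator
  ideal `chartAnn` of the chart module `Γ(Z, Z_{x_j}) ⧸ (chart ideal of J_{l+1})` for the window
  `(n - (l+1), max n 2]` — Kawasaki's `z_i ∈ 𝔞(R/(z_{i+1}, …, z_d)R)` chart by chart.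
The selection is `KawasakiFormSelection.exists_forms_avoiding_minimalPrimes` with the assignment
`annAssign` and the key lemma `exists_posHomog_annAssign_notMem`, re-indexed by `Fin.rev`.
[cite: Kawasaki2000, La. 5.3 and Thm. 5.1 (proof, p. 2539)] -/
theorem exists_kawasakiForms (P : Ideal (MvPolynomial (Fin (n + 1)) k))
    (hPhom : P.IsHomogeneous (grading k n)) [hP : P.IsPrime] {d : ℕ} (hd : 0 < d)
    (hPdim : ringKrullDim (MvPolynomial (Fin (n + 1)) k ⧸ P) = (d + 1 : ℕ)) :
    ∃ (z : Fin d → MvPolynomial (Fin (n + 1)) k) (N : Fin d → ℕ),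
      (∀ i, 0 < N i) ∧ (∀ i, (z i).IsHomogeneous (N i)) ∧
      z ⟨d - 1, by omega⟩ ∉ P ∧
      (∀ l : ℕ, l ≤ d → ringKrullDim (MvPolynomial (Fin (n + 1)) k ⧸
        (P ⊔ Ideal.span (z '' {i : Fin d | l ≤ (i : ℕ)}))) = (l + 1 : ℕ)) ∧
      (∀ (l : Fin d) (j : Fin (n + 1)), dehomAway k n j (z l) ∈
        chartAnn ι j (chartIdealOf ι (P ⊔ Ideal.span (z '' {i : Fin d | (l : ℕ) + 1 ≤ (i : ℕ)})) j)
          (Finset.Ioc (n - (l + 1)) (max n 2))) := by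
  have hPmin : ∀ 𝔮 ∈ P.minimalPrimes,
      ringKrullDim (MvPolynomial (Fin (n + 1)) k ⧸ 𝔮) = (d + 1 : ℕ) := by
    intro 𝔮 h𝔮
    rw [Ideal.minimalPrimes_eq_subsingleton_self] at h𝔮
    rw [Set.mem_singleton_iff.mp h𝔮]
    exact hPdim
  obtain ⟨r, N, hN, hrhom, hmem, havoid, hinv, hirr⟩ :=
    exists_forms_avoiding_minimalPrimes P hPhom hP.ne_top hPmin (annAssign ι) (d := d) (by omega)
      (fun J e _ _ hJhom hDe he 𝔭 h𝔭 =>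
        exists_posHomog_annAssign_notMem ι hJhom (e := e) (by omega) he h𝔭)
  refine ⟨fun i => r (Fin.rev i), fun i => N (Fin.rev i), fun i => hN _, fun i => hrhom _,
    ?_, ?_, ?_⟩
  · -- `z_{d-1} = r_0 ∉ P`
    have hrev : Fin.rev (⟨d - 1, by omega⟩ : Fin d) = ⟨0, hd⟩ := by
      ext; simp only [Fin.val_rev]; omega
    have h0 : {j : Fin d | (j : ℕ) < ((⟨0, hd⟩ : Fin d) : ℕ)} = ∅ := by
      ext j; simp
    have hP0 : P ∈ (P ⊔ Ideal.span (r '' {j : Fin d | (j : ℕ) < ((⟨0, hd⟩ : Fin d) : ℕ)})).minimalPrimes := by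
      rw [h0, Set.image_empty, Ideal.span_empty, sup_bot_eq, Ideal.minimalPrimes_eq_subsingleton_self]
      exact Set.mem_singleton P
    show r (Fin.rev ⟨d - 1, by omega⟩) ∉ P
    rw [hrev]
    exact havoid ⟨0, hd⟩ P hP0
  · -- dimensions
    intro l hl
    rw [image_comp_rev_ge r l]
    have hne : P ⊔ Ideal.span (r '' {j : Fin d | (j : ℕ) < d - l}) ≠ ⊤ :=
      ne_top_of_le_ne_top (irrelevant_ne_top (k := k) (n := n)) (hirr (d - l))
    exact ringKrullDim_quotient_eq_of_forall_minimalPrimes hne fun 𝔮 h𝔮 => by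
      rw [hinv (d - l) (by omega) 𝔮 h𝔮]
      congr 1
      omega
  · -- chart memberships
    intro l j
    have hm := hmem (Fin.rev l)
    rw [image_lt_rev r l] at hm
    have hc := dehomAway_mem_chartAnn_of_mem_annAssign ι hm j
    have hdim : ringKrullDim (MvPolynomial (Fin (n + 1)) k ⧸
        (P ⊔ Ideal.span ((fun i => r (Fin.rev i)) '' {i : Fin d | (l : ℕ) + 1 ≤ (i : ℕ)}))) =
        (l + 2 : ℕ) := by
      rw [image_comp_rev_ge r (l + 1)]
      have hne : P ⊔ Ideal.span (r '' {j : Fin d | (j : ℕ) < d - (l + 1)}) ≠ ⊤ :=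
        ne_top_of_le_ne_top (irrelevant_ne_top (k := k) (n := n)) (hirr (d - (l + 1)))
      refine ringKrullDim_quotient_eq_of_forall_minimalPrimes hne fun 𝔮 h𝔮 => ?_
      rw [hinv (d - (l + 1)) (by omega) 𝔮 h𝔮]
      congr 1
      omega
    rw [annWindow_eq hdim] at hc
    have harith : n + 1 - (l + 2) = n - (l + 1) := by omega
    rw [harith] at hc
    exact hc

/-! ## The chart ideals of `P + (forms)` and their dimension -/

omit [IsClosedImmersion ι] in
/-- **The chart ideal of `P + (S)` for forms `S`, when `P` dies on the chart**: if `ρ_j(P) B_j` maps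
to zero in `Γ(Z, Z_{x_j})` (e.g. `P = I_Z`), the chart ideal of `P + (S)` is generated by the
evaluated dehomogenisations of the forms in `S` (Kawasaki: the ideals `(z_{i+1}, …, z_d)𝒪_X` of the
charts). [cite: Kawasaki2000, Thm. 5.1 (proof, p. 2539)] -/
theorem chartIdealOf_sup_span_eq {P : Ideal (MvPolynomial (Fin (n + 1)) k)} {j : Fin (n + 1)}
    (hP : P.map (dehomAway k n j) ≤ RingHom.ker (evalAway ι (X j)))
    {S : Set (MvPolynomial (Fin (n + 1)) k)} (hS : ∀ s ∈ S, SetLike.IsHomogeneousElem (grading k n) s) :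
    chartIdealOf ι (P ⊔ Ideal.span S) j =
      Ideal.span ((fun s => evalAway ι (X j) (dehomAway k n j s)) '' S) := by
  rw [chartIdealOf_eq_span_dehomAway]
  refine le_antisymm (Ideal.span_le.mpr ?_) (Ideal.span_mono (Set.image_mono fun s hs =>
    ⟨Ideal.mem_sup_right (Ideal.subset_span hs), hS s hs⟩))
  rintro _ ⟨s, ⟨hs, -⟩, rfl⟩
  obtain ⟨p, hp, q, hq, rfl⟩ := Submodule.mem_sup.mp hs
  have hp0 : evalAway ι (X j) (dehomAway k n j p) = 0 :=
    (RingHom.mem_ker).mp (hP (Ideal.mem_map_of_mem _ hp))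
  have hq' : evalAway ι (X j) (dehomAway k n j q) ∈
      Ideal.span ((fun s => evalAway ι (X j) (dehomAway k n j s)) '' S) := by
    have h := Ideal.mem_map_of_mem ((evalAway ι (X j)).comp (dehomAway k n j)) hq
    rw [Ideal.map_span] at h
    exact h
  change evalAway ι (X j) (dehomAway k n j (p + q)) ∈ _
  rw [map_add, map_add, hp0, zero_add]
  exact hq'

omit [IsClosedImmersion ι] in
/-- For a homogeneous `J`, `ρ_j(J) B_j` lies in the preimage of the chart ideal of `J` (decompose
into forms). [cite: Kawasaki2000, Thm. 5.1 (proof)] -/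
theorem map_dehomAway_le_comap_chartIdealOf {J : Ideal (MvPolynomial (Fin (n + 1)) k)}
    (hJ : J.IsHomogeneous (grading k n)) (j : Fin (n + 1)) :
    J.map (dehomAway k n j) ≤ (chartIdealOf ι J j).comap (evalAway ι (X j)) := by
  classical
  rw [Ideal.map_le_iff_le_comap]
  intro G hG
  rw [Ideal.mem_comap, Ideal.mem_comap, ← DirectSum.sum_support_decompose (grading k n) G, map_sum,
    map_sum]
  exact Ideal.sum_mem _ fun i _ =>
    evalAway_dehomAway_mem_chartIdealOf ι j (hJ i hG) (DirectSum.decompose (grading k n) G i).2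

/-- **The chart module of `J` has dimension at most `dim V₊(J)`**: if `dim k[x]/J ≤ l + 1` for a
homogeneous `J` then `dim Γ(Z, Z_{x_j}) ⧸ (chart ideal of J) ≤ l` (`Γ(Z, Z_{x_j}) ⧸ I ≅ B_j ⧸ ρ⁻¹I`
for the surjection `B_j ↠ Γ(Z, Z_{x_j})` of a closed immersion, and
`ringKrullDim_quotient_le_of_map_dehomAway_le`). [cite: Kawasaki2000, La. 5.3 (1) (local reading, p. 2539)] -/
theorem ringKrullDim_chartQuot_chartIdealOf_le {J : Ideal (MvPolynomial (Fin (n + 1)) k)}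
    (hJ : J.IsHomogeneous (grading k n)) {l : ℕ}
    (hl : ringKrullDim (MvPolynomial (Fin (n + 1)) k ⧸ J) ≤ (l + 1 : ℕ)) (j : Fin (n + 1)) :
    ringKrullDim (ChartQuot ι (X j) (chartIdealOf ι J j)) ≤ l := by
  set I := chartIdealOf ι J j with hI
  set f : Away (grading k n) (X j : MvPolynomial (Fin (n + 1)) k) →+* Γ(Z, ZH ι (X j)) ⧸ I :=
    (Ideal.Quotient.mk I).comp (evalAway ι (X j)) with hf
  have hfs : Function.Surjective f :=
    Ideal.Quotient.mk_surjective.comp (evalAway_surjective ι (Segre.X_mem k j) one_pos)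
  have hker : RingHom.ker f = I.comap (evalAway ι (X j)) := by
    rw [hf, ← RingHom.comap_ker, Ideal.mk_ker]
  have e : (Away (grading k n) (X j : MvPolynomial (Fin (n + 1)) k) ⧸ I.comap (evalAway ι (X j))) ≃+*
      ChartQuot ι (X j) I :=
    (Ideal.quotEquivOfEq hker.symm).trans (RingHom.quotientKerEquivOfSurjective hfs)
  rw [← ringKrullDim_eq_of_ringEquiv e]
  exact ringKrullDim_quotient_le_of_map_dehomAway_le j hJ (map_dehomAway_le_comap_chartIdealOf ι hJ j) hl

section Lists

variable {α : Type u}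

/-- The entries of `(z_0, …, z_{d-1}).drop l` are the `z_i` with `l ≤ i`. [folklore] -/
private theorem setOf_mem_drop_ofFn {d : ℕ} (g : Fin d → α) (l : ℕ) :
    {b | b ∈ (List.ofFn g).drop l} = g '' {i : Fin d | l ≤ (i : ℕ)} := by
  ext b
  simp only [Set.mem_setOf_eq, Set.mem_image]
  constructor
  · intro hb
    obtain ⟨i, hi, rfl⟩ := List.mem_iff_getElem.mp hb
    refine ⟨⟨l + i, ?_⟩, ?_, ?_⟩
    · simp only [List.length_drop, List.length_ofFn] at hi; omega
    · simp
    · simp only [List.getElem_drop, List.getElem_ofFn]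
  · rintro ⟨i, hi, rfl⟩
    rw [List.mem_iff_getElem]
    refine ⟨i - l, ?_, ?_⟩
    · simp only [List.length_drop, List.length_ofFn]; omega
    · simp only [List.getElem_drop, List.getElem_ofFn]
      congr 1
      ext
      simp only
      omega

end Lists

omit [IsClosedImmersion ι] in
/-- **The chart ideal of `J_l = P + (z_l, …, z_{d-1})` is the list ideal of the chart values
`z_l / x_j^{N_l}, …`** (the currency `Ideal.ofList` of `KawasakiPointwise.lean` /
`KawasakiChartStalk.stalkIdealMap_ofList_eq`), when `P` dies on the chart.
[cite: Kawasaki2000, Thm. 5.1 (proof, p. 2539)] -/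
theorem chartIdealOf_sup_span_image_eq_ofList {P : Ideal (MvPolynomial (Fin (n + 1)) k)}
    {j : Fin (n + 1)} (hP : P.map (dehomAway k n j) ≤ RingHom.ker (evalAway ι (X j)))
    {d : ℕ} (z : Fin d → MvPolynomial (Fin (n + 1)) k) (N : Fin d → ℕ)
    (hz : ∀ i, (z i).IsHomogeneous (N i)) (l : ℕ) :
    chartIdealOf ι (P ⊔ Ideal.span (z '' {i : Fin d | l ≤ (i : ℕ)})) j =
      Ideal.ofList (((List.ofFn fun i => Away.mk (grading k n) (Segre.X_mem k j) (N i) (z i)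
        (by simpa using (hz i : z i ∈ grading k n (N i)))).drop l).map (evalAway ι (X j))) := by
  have hS : ∀ s ∈ z '' {i : Fin d | l ≤ (i : ℕ)}, SetLike.IsHomogeneousElem (grading k n) s := by
    rintro _ ⟨i, -, rfl⟩
    exact ⟨N i, hz i⟩
  have hmk : ∀ i : Fin d, dehomAway k n j (z i) = Away.mk (grading k n) (Segre.X_mem k j) (N i) (z i)
      (by simpa using (hz i : z i ∈ grading k n (N i))) := fun i =>
    dehomAway_of_mem j (hz i : z i ∈ grading k n (N i))
  rw [chartIdealOf_sup_span_eq ι hP hS]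
  change Ideal.span _ = Ideal.span {r | r ∈ _}
  congr 1
  ext b
  constructor
  · rintro ⟨_, ⟨i, hi, rfl⟩, rfl⟩
    change evalAway ι (X j) (dehomAway k n j (z i)) ∈ _
    rw [Set.mem_setOf_eq, List.mem_map]
    refine ⟨Away.mk (grading k n) (Segre.X_mem k j) (N i) (z i)
      (by simpa using (hz i : z i ∈ grading k n (N i))), ?_, by rw [hmk i]⟩
    have h : Away.mk (grading k n) (Segre.X_mem k j) (N i) (z i)
        (by simpa using (hz i : z i ∈ grading k n (N i))) ∈
        {b | b ∈ (List.ofFn fun i => Away.mk (grading k n) (Segre.X_mem k j) (N i) (z i)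
          (by simpa using (hz i : z i ∈ grading k n (N i)))).drop l} := by
      rw [setOf_mem_drop_ofFn]
      exact ⟨i, hi, rfl⟩
    exact h
  · intro hb
    rw [Set.mem_setOf_eq, List.mem_map] at hb
    obtain ⟨a, ha, rfl⟩ := hb
    have ha' : a ∈ {b | b ∈ (List.ofFn fun i => Away.mk (grading k n) (Segre.X_mem k j) (N i) (z i)
        (by simpa using (hz i : z i ∈ grading k n (N i)))).drop l} := ha
    rw [setOf_mem_drop_ofFn] at ha'
    obtain ⟨i, hi, rfl⟩ := ha'
    exact ⟨z i, ⟨i, hi, rfl⟩, by simp only [hmk i]⟩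

end Literature.AlgebraicGeometry.Resolution

end
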